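import Mathlib
import Summits.HodgeConjecture.FermatCycles.HodgeFermatChiThreeA

/-!
# The χ₃-moment of a CM type: LEMMA E at the character χ₃ × 1 — part 2: THEOREM (Σν) and corollaries (`HodgeFermat/ChiThree.lean`)

Tree copy (part 2 of 2) of the module `HodgeFermat/ChiThree.lean` of the sibling cell's standalone package
`run/shared/lean/pub/pub-hodgefermat/lean/HodgeFermat/` (474 lines, sha256 `1b65ac1fe913f0ab…`), source lines 266–474 (THEOREM (Σν), the corollaries at the prime 3, kernel instance at m = 33).
Filed by cell `pub-hfermat`, seat prover-1 gen-0, on the COORDINATOR KEEPER RULING of 2026-08-25 (gem sweep H1: take the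
off-gate kernel theorem `thmFstar` — `HodgeFermat/DecodingFinal.lean:29` — through the gate); this file is one link of the
minimal import closure of `thmFstar`.  The source module's declarations are VERBATIM those of the cell record
`check/DecodingFinal_standalone.lean` (27 bodies, 454 223 B, sha256 dca6f17de93119a6…, hub `lean check` rc 0, 130.1 s; pub-hodgefermat `CERT.md` l.978, GATE HF-G32).
Deviations from the source module, exhaustively: the `import` lines (tree modules `Summits.HodgeConjecture.FermatCycles.
HodgeFermat*` instead of `HodgeFermat.*`); this module docstring; the namespace/`open`/`variable` preamble (source l.48–53) is repeated at the top because the module is split; one-line docstrings added (gate lint) to `chi3_ne_zero`, `inH_mod`. The module docstring is quoted in full in part 1.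
Every other line — in particular every declaration's statement and proof — is byte-identical to the source.
HONEST FRAMING: explicit algebraic cycles for specific Hodge classes on Fermat/Delsarte varieties; residual open instances
listed; no claim on general Hodge.  (This file is arithmetic of CM types; it claims nothing about cycles.)
-/

set_option autoImplicit false

namespace HodgeFermat.KRFree.ChiThree

open Finset HodgeFermat.KRFree.LemmaN

/-! ## THEOREM (Σν): the χ₃-moment is an invariant of the CM type -/

/-- **THEOREM (Σν), HF-G31** — LEMMA E of `tables/DPRIME-THEOREM.md` §6 at the character `χ₃ × 1`.  At a level
`m = 3n` with `3 ∤ n` and `3 ∤ φ(n)` (no prime `≡ 1 (mod 3)` divides `n`, `three_dvd_totient_iff`): two zero-sum triples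
of the same CM type whose entries are each divisible by `3` or a unit mod `m`, with third entries `≢ 0 (mod m)`, have the
same `ν = Σ χ₃(entry)`. -/
theorem nu_eq_of_sameType (n a b c a' b' c' : ℕ) (hn : 0 < n) (h3n : ¬ 3 ∣ n) (hφ : ¬ 3 ∣ Nat.totient n)
    (hs : 3 * n ∣ a + b + c) (hs' : 3 * n ∣ a' + b' + c')
    (ha : 3 ∣ a ∨ Nat.Coprime a (3 * n)) (hb : 3 ∣ b ∨ Nat.Coprime b (3 * n)) (hc : 3 ∣ c ∨ Nat.Coprime c (3 * n))
    (ha' : 3 ∣ a' ∨ Nat.Coprime a' (3 * n)) (hb' : 3 ∣ b' ∨ Nat.Coprime b' (3 * n))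
    (hc' : 3 ∣ c' ∨ Nat.Coprime c' (3 * n))
    (hc0 : ¬ 3 * n ∣ c) (hc0' : ¬ 3 * n ∣ c')
    (hT : SameType (3 * n) (a, b, c) (a', b', c')) :
    nu (a, b, c) = nu (a', b', c') := by
  have hm : 0 < 3 * n := by omega
  -- the residue sums (carries) agree at every unit
  have hR : ∀ t ∈ units (3 * n), rsum (3 * n) (a, b, c) t = rsum (3 * n) (a', b', c') t := by
    intro t ht
    simp only [units, mem_filter, mem_range] at ht
    have htc : ¬ 3 * n ∣ t * c := fun h => hc0 (Nat.Coprime.dvd_of_dvd_mul_left ht.2.symm h)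
    have htc' : ¬ 3 * n ∣ t * c' := fun h => hc0' (Nat.Coprime.dvd_of_dvd_mul_left ht.2.symm h)
    obtain ⟨h1, h2⟩ := rsum_cases hm hs htc
    obtain ⟨h1', h2'⟩ := rsum_cases hm hs' htc'
    have h := hT t ht.2
    rw [h2, h2'] at h
    rcases h1 with e | e <;> rcases h1' with e' | e'
    · omega
    · exact absurd (h.mp e) (by omega)
    · exact absurd (h.mpr e') (by omega)
    · omega
  have hsum : ∑ t ∈ units (3 * n), chi3 t * (rsum (3 * n) (a, b, c) t : ℤ)
      = ∑ t ∈ units (3 * n), chi3 t * (rsum (3 * n) (a', b', c') t : ℤ) :=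
    Finset.sum_congr rfl (fun t ht => by rw [hR t ht])
  rw [sum_chi3_rsum, sum_chi3_rsum, cm_eq hn h3n ha, cm_eq hn h3n hb, cm_eq hn h3n hc, cm_eq hn h3n ha',
    cm_eq hn h3n hb', cm_eq hn h3n hc'] at hsum
  have hS := S_ne_zero h3n hφ
  have hprod : (nu (a, b, c) - nu (a', b', c')) * S (3 * n) = 0 := by
    simp only [nu]
    linear_combination hsum
  rcases mul_eq_zero.mp hprod with h | h
  · linarith
  · exact absurd h hS

/-- THEOREM (Σν) in the scope of LEMMA E (`m₀ = 3`): all six entries units mod `n`, `n > 1` -/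
theorem nu_eq_of_sameType_units (n a b c a' b' c' : ℕ) (h1n : 1 < n) (h3n : ¬ 3 ∣ n)
    (hφ : ¬ 3 ∣ Nat.totient n)
    (hs : 3 * n ∣ a + b + c) (hs' : 3 * n ∣ a' + b' + c')
    (ha : Nat.Coprime a n) (hb : Nat.Coprime b n) (hc : Nat.Coprime c n)
    (ha' : Nat.Coprime a' n) (hb' : Nat.Coprime b' n) (hc' : Nat.Coprime c' n)
    (hT : SameType (3 * n) (a, b, c) (a', b', c')) :
    nu (a, b, c) = nu (a', b', c') := by
  have adm : ∀ x, Nat.Coprime x n → (3 ∣ x ∨ Nat.Coprime x (3 * n)) := by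
    intro x hx
    by_cases h : 3 ∣ x
    · exact Or.inl h
    · exact Or.inr (Nat.Coprime.mul_right
        (Nat.coprime_comm.mp ((Nat.Prime.coprime_iff_not_dvd Nat.prime_three).mpr h)) hx)
  have nz : ∀ x, Nat.Coprime x n → ¬ 3 * n ∣ x := by
    intro x hx h
    have h1 : n ∣ x := dvd_trans (dvd_mul_left n 3) h
    have h2 : n = 1 := Nat.Coprime.eq_one_of_dvd hx.symm h1
    omega
  exact nu_eq_of_sameType n a b c a' b' c' (by omega) h3n hφ hs hs' (adm a ha) (adm b hb) (adm c hc)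
    (adm a' ha') (adm b' hb') (adm c' hc') (nz c hc) (nz c' hc') hT

/-- THEOREM (Σν) with the level hypothesis in prime form: no prime `q ≡ 1 (mod 3)` divides `n` -/
theorem nu_eq_of_sameType_primes (n a b c a' b' c' : ℕ) (h1n : 1 < n) (h3n : ¬ 3 ∣ n)
    (hq : ∀ q, Nat.Prime q → q ∣ n → q % 3 ≠ 1)
    (hs : 3 * n ∣ a + b + c) (hs' : 3 * n ∣ a' + b' + c')
    (ha : Nat.Coprime a n) (hb : Nat.Coprime b n) (hc : Nat.Coprime c n)
    (ha' : Nat.Coprime a' n) (hb' : Nat.Coprime b' n) (hc' : Nat.Coprime c' n)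
    (hT : SameType (3 * n) (a, b, c) (a', b', c')) :
    nu (a, b, c) = nu (a', b', c') := by
  refine nu_eq_of_sameType_units n a b c a' b' c' h1n h3n ?_ hs hs' ha hb hc ha' hb' hc' hT
  intro h
  obtain ⟨q, hqp, hqn, hq1⟩ := (three_dvd_totient_iff (by omega) h3n).mp h
  exact hq q hqp hqn hq1

/-! ## COROLLARY: no (U, Z1) and no (U, Z3) at the prime 3 -/

/-- a zero-sum triple prime to `3` has `a ≡ b ≡ c (mod 3)`: `ν = 3χ₃(a) = ±3` -/
lemma nu_of_units {a b c : ℕ} (hs : 3 ∣ a + b + c) (ha : ¬ 3 ∣ a) (hb : ¬ 3 ∣ b) (hc : ¬ 3 ∣ c) :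
    nu (a, b, c) = 3 * chi3 a := by
  simp only [nu, chi3]
  split_ifs <;> omega

/-- a zero-sum triple with an entry divisible by `3` has `ν = 0` -/
lemma nu_of_dvd {a b c : ℕ} (hs : 3 ∣ a + b + c) (h : 3 ∣ a ∨ 3 ∣ b ∨ 3 ∣ c) : nu (a, b, c) = 0 := by
  simp only [nu, chi3]
  split_ifs <;> omega

/-- `χ₃(a) ≠ 0` for `3 ∤ a` -/
lemma chi3_ne_zero {a : ℕ} (ha : ¬ 3 ∣ a) : chi3 a ≠ 0 := by
  unfold chi3
  split_ifs <;> omega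

/-- **COROLLARY (U ⟺ U), HF-G31.**  Under the hypotheses of THEOREM (Σν): `T` has all entries prime to `3` iff `T′` does —
the patterns (U, Z1), (Z1, U), (U, Z3), (Z3, U) at the prime `3` do not occur. -/
theorem U_iff_of_sameType (n a b c a' b' c' : ℕ) (hn : 0 < n) (h3n : ¬ 3 ∣ n) (hφ : ¬ 3 ∣ Nat.totient n)
    (hs : 3 * n ∣ a + b + c) (hs' : 3 * n ∣ a' + b' + c')
    (ha : 3 ∣ a ∨ Nat.Coprime a (3 * n)) (hb : 3 ∣ b ∨ Nat.Coprime b (3 * n)) (hc : 3 ∣ c ∨ Nat.Coprime c (3 * n))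
    (ha' : 3 ∣ a' ∨ Nat.Coprime a' (3 * n)) (hb' : 3 ∣ b' ∨ Nat.Coprime b' (3 * n))
    (hc' : 3 ∣ c' ∨ Nat.Coprime c' (3 * n))
    (hc0 : ¬ 3 * n ∣ c) (hc0' : ¬ 3 * n ∣ c')
    (hT : SameType (3 * n) (a, b, c) (a', b', c')) :
    (¬ 3 ∣ a ∧ ¬ 3 ∣ b ∧ ¬ 3 ∣ c) ↔ (¬ 3 ∣ a' ∧ ¬ 3 ∣ b' ∧ ¬ 3 ∣ c') := by
  have h := nu_eq_of_sameType n a b c a' b' c' hn h3n hφ hs hs' ha hb hc ha' hb' hc' hc0 hc0' hT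
  have h3 : 3 ∣ a + b + c := dvd_trans (dvd_mul_right 3 n) hs
  have h3' : 3 ∣ a' + b' + c' := dvd_trans (dvd_mul_right 3 n) hs'
  constructor
  · rintro ⟨h1, h2, h4⟩
    have hv := nu_of_units h3 h1 h2 h4
    have hz := chi3_ne_zero h1
    by_contra hcon
    have hd : 3 ∣ a' ∨ 3 ∣ b' ∨ 3 ∣ c' := by
      by_contra hd
      push Not at hd
      exact hcon hd
    have hv' := nu_of_dvd h3' hd
    rw [← h, hv] at hv'
    exact hz (by linarith)
  · rintro ⟨h1, h2, h4⟩
    have hv := nu_of_units h3' h1 h2 h4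
    have hz := chi3_ne_zero h1
    by_contra hcon
    have hd : 3 ∣ a ∨ 3 ∣ b ∨ 3 ∣ c := by
      by_contra hd
      push Not at hd
      exact hcon hd
    have hv' := nu_of_dvd h3 hd
    rw [h, hv] at hv'
    exact hz (by linarith)

/-- **COROLLARY (no (U, Z) at 3), HF-G31** in the scope of LEMMA E: at `m = 3n`, `n > 1`, `3 ∤ n`, no prime `≡ 1 (mod 3)`
dividing `n`, two zero-sum triples with all entries units mod `n` and the same CM type: if `a, b, c` are prime to `3`,
so are `a′, b′, c′`. -/
theorem no_UZ_three (n a b c a' b' c' : ℕ) (h1n : 1 < n) (h3n : ¬ 3 ∣ n)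
    (hq : ∀ q, Nat.Prime q → q ∣ n → q % 3 ≠ 1)
    (hs : 3 * n ∣ a + b + c) (hs' : 3 * n ∣ a' + b' + c')
    (ha : Nat.Coprime a n) (hb : Nat.Coprime b n) (hc : Nat.Coprime c n)
    (ha' : Nat.Coprime a' n) (hb' : Nat.Coprime b' n) (hc' : Nat.Coprime c' n)
    (hT : SameType (3 * n) (a, b, c) (a', b', c'))
    (hU : ¬ 3 ∣ a ∧ ¬ 3 ∣ b ∧ ¬ 3 ∣ c) : ¬ 3 ∣ a' ∧ ¬ 3 ∣ b' ∧ ¬ 3 ∣ c' := by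
  have h := nu_eq_of_sameType_primes n a b c a' b' c' h1n h3n hq hs hs' ha hb hc ha' hb' hc' hT
  have h3 : 3 ∣ a + b + c := dvd_trans (dvd_mul_right 3 n) hs
  have h3' : 3 ∣ a' + b' + c' := dvd_trans (dvd_mul_right 3 n) hs'
  have hv := nu_of_units h3 hU.1 hU.2.1 hU.2.2
  have hz := chi3_ne_zero hU.1
  by_contra hcon
  have hd : 3 ∣ a' ∨ 3 ∣ b' ∨ 3 ∣ c' := by
    by_contra hd
    push Not at hd
    exact hcon hd
  have hv' := nu_of_dvd h3' hd
  rw [← h, hv] at hv'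
  exact hz (by linarith)

/-- **COROLLARY (U, U same class), HF-G31**: under the hypotheses of THEOREM (Σν), two all-prime-to-3 triples of the same
CM type lie in the same class mod `3` (`a ≡ b ≡ c ≡ a′ ≡ b′ ≡ c′`). -/
theorem UU_class (n a b c a' b' c' : ℕ) (hn : 0 < n) (h3n : ¬ 3 ∣ n) (hφ : ¬ 3 ∣ Nat.totient n)
    (hs : 3 * n ∣ a + b + c) (hs' : 3 * n ∣ a' + b' + c')
    (ha : Nat.Coprime a (3 * n)) (hb : Nat.Coprime b (3 * n)) (hc : Nat.Coprime c (3 * n))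
    (ha' : Nat.Coprime a' (3 * n)) (hb' : Nat.Coprime b' (3 * n)) (hc' : Nat.Coprime c' (3 * n))
    (hT : SameType (3 * n) (a, b, c) (a', b', c')) : a % 3 = a' % 3 := by
  have h1m : 1 < 3 * n := by omega
  have h3m : 3 ∣ 3 * n := dvd_mul_right 3 n
  have nz : ∀ x, Nat.Coprime x (3 * n) → ¬ 3 * n ∣ x := fun x hx h => by
    have h2 : 3 * n = 1 := Nat.Coprime.eq_one_of_dvd hx.symm h
    omega
  have h := nu_eq_of_sameType n a b c a' b' c' hn h3n hφ hs hs' (Or.inr ha) (Or.inr hb) (Or.inr hc)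
    (Or.inr ha') (Or.inr hb') (Or.inr hc') (nz c hc) (nz c' hc') hT
  have h3 : 3 ∣ a + b + c := dvd_trans h3m hs
  have h3' : 3 ∣ a' + b' + c' := dvd_trans h3m hs'
  rw [nu_of_units h3 (not_three_dvd_of_coprime h3m ha) (not_three_dvd_of_coprime h3m hb)
      (not_three_dvd_of_coprime h3m hc),
    nu_of_units h3' (not_three_dvd_of_coprime h3m ha') (not_three_dvd_of_coprime h3m hb')
      (not_three_dvd_of_coprime h3m hc')] at h
  have ha3 := not_three_dvd_of_coprime h3m ha
  have ha3' := not_three_dvd_of_coprime h3m ha'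
  unfold chi3 at h
  split_ifs at h <;> omega

/-! ## Kernel instance (non-vacuity) at `m = 33` -/

/-- `H_T` membership depends only on `t mod N` -/
lemma inH_mod (N : ℕ) (T : ℕ × ℕ × ℕ) (t : ℕ) : InH N T (t % N) ↔ InH N T t := by
  unfold InH
  rw [Nat.mod_mul_mod, Nat.mod_mul_mod]

/-- a CM-type coincidence is checked on the residues `t < N` -/
lemma sameType_of_fin {N : ℕ} {T T' : ℕ × ℕ × ℕ} (hN : 0 < N)
    (h : ∀ t < N, Nat.Coprime t N → (InH N T t ↔ InH N T' t)) : SameType N T T' := by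
  intro t ht
  have h1 := h (t % N) (Nat.mod_lt t hN) ((coprime_mod_iff t N).mpr ht)
  rwa [inH_mod, inH_mod] at h1

/-- `(1, 9, 23) ∼ (3, 9, 21)` at `m = 33 = 3·11`: a Z1-at-3 and a Z3-at-3 triple of the same CM type, all entries units
mod `11`, `11 ≡ 2 (mod 3)` -/
theorem sameType_33 : SameType (3 * 11) (1, 9, 23) (3, 9, 21) := sameType_of_fin (by norm_num) (by decide)

/-- THEOREM (Σν) instantiated on these data (its hypotheses are satisfiable; here `ν = 0 = 0`) -/
example : nu (1, 9, 23) = nu (3, 9, 21) :=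
  nu_eq_of_sameType_primes 11 1 9 23 3 9 21 (by norm_num) (by norm_num)
    (fun q hq hqn => by
      have := (Nat.prime_dvd_prime_iff_eq hq (by norm_num)).mp hqn
      subst this; norm_num)
    (by norm_num) (by norm_num) (by decide) (by decide) (by decide) (by decide) (by decide) (by decide) sameType_33

example : nu (1, 9, 23) = 0 ∧ nu (3, 9, 21) = 0 ∧ nu (1, 1, 19) = 3 ∧ nu (1, 3, 17) = 0 := by decide

end HodgeFermat.KRFree.ChiThree
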